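import Mathlib
import Literature.Combinatorics.Hinz2018.FourInARowTower
import HarnessLib

/-!
# Berend–Sapir–Solomon's «hardest task» of the Four-in-a-row Tower of Hanoi — PROVED

Discharge of the named fact `Literature.Combinatorics.Hinz2018.MoveGraph.BerendSapirSolomonHardest` of
`Literature/Combinatorics/Hinz2018/FourInARowTower.lean` (Hinz–Klavžar–Petr 2018, Ch. 8 §8.3.5, p. 349, quoting
[50] = D. Berend, A. Sapir, S. Solomon, *The Tower of Hanoi problem on Pathₕ graphs*, Discrete Appl. Math. 160
(2012) 1465–1483, Theorem 3.2 (a): «$|R_{4,i,n} \rightarrow R_{4,j,n}| < |R_{4,1,n} \rightarrow R_{4,4,n}|$ for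
$1 \le i < j \le 4$, $(i,j) \neq (1,4)$» for `n ≥ 1`), as `BerendSapirSolomonHardest_holds`, by the PRINTED
PROOF of [50, §4.1] (held preprint `paper:arxiv-1102.4885`, p0006): Lemma 4.1 for `h = 4` and the two
displayed chains of inequalities «due to symmetries».

Topic `Combinatorics/Hinz2018`; namespace `Literature.Combinatorics.Hinz2018.MoveGraph` (the carpet's, so that
the discharge is literally `BerendSapirSolomonHardest_holds`).  THEOREMS ONLY (no `def`, no named fact, no
`sorry`, no instance, no notation; D-0026 net debt −1).  Cell `pub/hodgecm-mathlib`, seat B-typ03 (g36)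
(Literature support, off the HC_CM cone: HC_CM is proved only modulo its printed citations until rung 0 closes).

## The printed proof and its rendering

Pegs: the source's `1, 2, 3, 4` in a row are the tree's `path4 = 0 – 1 – 2 – 3` (`StarHanoiGraphs`), states
of `n` discs are words `Fin n → Fin 4` (index `0` = smallest disc, `MoveGraphSolvability.stateGraph`), `d` =
`SimpleGraph.dist` of `stateGraph path4 n` (connected by Proposition 8.4, ★ `stateGraph_connected`).

* **Lemma 4.1** (`h = 4`; [50] p. 6): «Let $C$ be a configuration with $n \ge 1$ disks, arranged arbitrarily
  on pegs $1,\ldots,h-2$, with pegs $h-1$ and $h$ empty. Then: $|C \rightarrow R_{h,h-2,n}| < |C \rightarrow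
  R_{h,h,n}|$, $|C \rightarrow R_{h,h-1,n}| < |C \rightarrow R_{h,h,n}|$.» — `bss_lemma41` below: for `C : Fin
  (n+1) → Fin 4` supported on the pegs `{0, 1}`, `d(C, 1^{n+1}) < d(C, 3^{n+1})` and `d(C, 2^{n+1}) < d(C,
  3^{n+1})`.  PROOF AS PRINTED («The proof is by induction on $n$. … Before the last move of disk $n$ (to peg
  $h$), a configuration $C'$, in which all $n-1$ disks … are distributed among pegs $1,\ldots,h-2$, is
  reached. … By the induction hypothesis, there exists a move-sequence $M''_{h-2}$ that transfers from $C'$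
  to $R_{h,h-2,n-1}$, which is strictly shorter than $M''$. Let $M'_{h-2}$ be the move-sequence obtained from
  $M'$ by omitting all moves disk $n$ makes after reaching peg $h-2$ for the first time. Concatenating …»),
  organised as DISTANCE ARITHMETIC: a geodesic `C → 3^{n+1}` is reversed and split at the FIRST move of the
  largest disc (`exists_first_move_last`: it goes `3 → 2` while every smaller disc sits on `{0,1}` — the
  print's `C'` is `Fin.init` of that state); the print's «$M''$ restricted to the $n-1$ small disks» is the
  1-Lipschitz projection `Fin.init` (`dist_init_le`: a move of the largest disc projects to a non-move, any
  other move to the same move); the print's lift of `M''_{h-2}` under the idle disc `n` is the tree's ★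
  `idleHom` (`dist_snoc_le`); «omitting all moves disk $n$ makes after reaching peg $h-2$ for the first time»
  is one more first-hit split (`exists_first_arrival_one`) followed by the same projection-and-lift.  The
  induction hypothesis is only needed in the WEAK form `≤` (`lemma41_weak`, from `n = 0`): strictness comes from
  the deleted last move of the largest disc, exactly as in the print («strictly shorter than $M$»).
* **Theorem 3.2 (a)** ([50] p. 6): «Due to symmetries, there are actually only four essentially distinct
  perfect tasks … By Lemma 4.1, taking $h=4$ and $C$ to be various perfect configurations, we obtain for any
  $n \ge 1$: $|R_{4,1,n} \rightarrow R_{4,2,n}| < |R_{4,1,n} \rightarrow R_{4,4,n}|$; $|R_{4,2,n} \rightarrow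
  R_{4,3,n}| < |R_{4,2,n} \rightarrow R_{4,4,n}| = |R_{4,1,n} \rightarrow R_{4,3,n}| < |R_{4,1,n} \rightarrow
  R_{4,4,n}|$.» — the symmetry is the reflection `Fin.rev` of `path4` (`dist_rev_comp`, through the tree's ★
  `pegMapHom`), and the five pairs of ★ `bss_pairs` are dispatched by these two chains
  (`BerendSapirSolomonHardest_holds`).

Uses BY NAME: ★ `stateGraph`, ★ `path4`, ★ `stateGraph_connected` + ★ `order_four_connected` (Prop. 8.4), ★
`idleHom` (`ThreeSmoothNumbers`), ★ `pegMapHom` ∕ `pegMapHom_apply` and the fact itself (`FourInARowTower`).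
-/

namespace Literature.Combinatorics.Hinz2018.MoveGraph

open SimpleGraph

/-! ## Tools: homomorphisms, connectivity, the four pegs -/

section Tools

variable {V : Type*}

/-- A graph homomorphism does not increase the distance between two connected vertices. [folklore] -/
private theorem bssh_dist_map_le {W W' : Type*} {G : SimpleGraph W} {H : SimpleGraph W'} (ψ : G →g H)
    {u v : W} (huv : G.Reachable u v) : H.dist (ψ u) (ψ v) ≤ G.dist u v := by
  obtain ⟨p, hp⟩ := huv.exists_walk_length_eq_dist
  have := SimpleGraph.dist_le (p.map ψ)
  rwa [SimpleGraph.Walk.length_map, hp] at this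

/-- `H^n_{P_{1+3}}` is connected (Proposition 8.4 for the connected move graph `P_{1+3}` on four pegs).
[cite: HinzKlavzarPetr2018, Ch. 8 §8.1, Proposition 8.4, p. 317] -/
private theorem bssh_connected (n : ℕ) : (stateGraph path4 n).Connected :=
  stateGraph_connected order_four_connected.2.2.2.2.2 (by rw [Fintype.card_fin]; omega) n

/-- In `P_{1+3} = 0 – 1 – 2 – 3` the only neighbour of `3` is `2`. [folklore] -/
private theorem bssh_eq_two_of_adj_three {x : Fin 4} (h : path4.Adj 3 x) : x = 2 := by
  revert x; decide

/-- In `P_{1+3} = 0 – 1 – 2 – 3` the only neighbour of `0` is `1`. [folklore] -/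
private theorem bssh_eq_one_of_adj_zero {x : Fin 4} (h : path4.Adj 0 x) : x = 1 := by
  revert x; decide

/-- A peg other than `2` and `3` is one of `0, 1`. [folklore] -/
private theorem bssh_val_le_one {x : Fin 4} (h3 : x ≠ 3) (h2 : x ≠ 2) : x.val ≤ 1 := by
  revert x; decide

/-- A peg among `0, 1` other than `1` is `0`. [folklore] -/
private theorem bssh_eq_zero {x : Fin 4} (h : x.val ≤ 1) (h1 : x ≠ 1) : x = 0 := by
  revert x; decide

/-- The reflection `i ↦ 3 − i` is an automorphism of the path `0 – 1 – 2 – 3`. [folklore] -/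
private theorem bssh_adj_rev {a b : Fin 4} (h : path4.Adj a b) : path4.Adj (Fin.rev a) (Fin.rev b) := by
  revert a b; decide

/-- `c^n c = c^{n+1}` for `Fin.snoc`. [folklore] -/
private theorem bssh_snoc_const {α : Type*} (n : ℕ) (c : α) :
    (Fin.snoc (fun _ : Fin n => c) c : Fin (n + 1) → α) = fun _ => c := by
  funext i
  induction i using Fin.lastCases with
  | last => simp only [Fin.snoc_last]
  | cast j => simp only [Fin.snoc_castSucc]

end Tools

/-! ## The projection dropping the largest disc, and the idle lift -/

section Projection

variable {V : Type*}

/-- Dropping the largest disc maps a move of `H_G^{n+1}` to a move of `H_G^n` (any smaller disc moves under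
the same rule) or to a non-move (the largest disc moved) — the print's «$M''$ … considered as a
configuration of $n-1$ disks». [folklore] -/
private theorem bssh_init_adj_or_eq (M : SimpleGraph V) {n : ℕ} {s t : Fin (n + 1) → V}
    (h : (stateGraph M (n + 1)).Adj s t) :
    Fin.init s = Fin.init t ∨ (stateGraph M n).Adj (Fin.init s) (Fin.init t) := by
  obtain ⟨d, had, hoff, hsm⟩ := h
  rcases Fin.eq_castSucc_or_eq_last d with ⟨d', rfl⟩ | rfl
  · right
    refine ⟨d', had, fun e he => ?_, fun e he => ?_⟩
    · exact hoff (Fin.castSucc e) fun h => he (Fin.castSucc_injective _ h)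
    · exact hsm (Fin.castSucc e) (Fin.castSucc_lt_castSucc_iff.mpr he)
  · left
    funext e
    exact (hoff (Fin.castSucc e) (Fin.castSucc_lt_last e).ne).symm

/-- Along any walk of `H_G^{n+1}` the projected states are joined by a walk of `H_G^n` that is not longer.
[folklore] -/
private theorem bssh_exists_walk_init (M : SimpleGraph V) {n : ℕ} {s t : Fin (n + 1) → V}
    (p : (stateGraph M (n + 1)).Walk s t) :
    ∃ q : (stateGraph M n).Walk (Fin.init s) (Fin.init t), q.length ≤ p.length := by
  induction p with
  | nil => exact ⟨Walk.nil, le_rfl⟩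
  | @cons a b c h p ih =>
    obtain ⟨q, hq⟩ := ih
    rcases bssh_init_adj_or_eq M h with heq | hadj
    · refine ⟨q.copy heq.symm rfl, ?_⟩
      rw [Walk.length_copy, Walk.length_cons]
      omega
    · refine ⟨Walk.cons hadj q, ?_⟩
      rw [Walk.length_cons, Walk.length_cons]
      omega

/-- The projection `Fin.init` (forget the largest disc) is 1-Lipschitz on `H^·_{P_{1+3}}`. [folklore] -/
private theorem bssh_dist_init_le {n : ℕ} (s t : Fin (n + 1) → Fin 4) :
    (stateGraph path4 n).dist (Fin.init s) (Fin.init t) ≤ (stateGraph path4 (n + 1)).dist s t := by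
  obtain ⟨p, hp⟩ := (bssh_connected (n + 1)).exists_walk_length_eq_dist s t
  obtain ⟨q, hq⟩ := bssh_exists_walk_init path4 p
  exact (dist_le q).trans (hp ▸ hq)

/-- The tree's `idleHom` with one idle disc appends it by `Fin.snoc`. [folklore] -/
private theorem bssh_idleHom_one (M : SimpleGraph V) (n : ℕ) (c : V) (s : Fin n → V) :
    idleHom M n 1 c s = (Fin.snoc s c : Fin (n + 1) → V) := by
  show Fin.append s (fun _ : Fin 1 => c) = _
  rw [Fin.append_right_eq_snoc]

/-- With the largest disc idle on a fixed peg `c`, the smaller discs move as in `H^n_{P_{1+3}}` (the print's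
lift of `M''_{h-2}`): `d(s c, t c) ≤ d(s, t)`. [folklore] -/
private theorem bssh_dist_snoc_le {n : ℕ} (s t : Fin n → Fin 4) (c : Fin 4) :
    (stateGraph path4 (n + 1)).dist (Fin.snoc s c : Fin (n + 1) → Fin 4) (Fin.snoc t c) ≤
      (stateGraph path4 n).dist s t := by
  have h := bssh_dist_map_le (idleHom path4 n 1 c) ((bssh_connected n).preconnected s t)
  rwa [bssh_idleHom_one, bssh_idleHom_one] at h

end Projection

/-! ## The two first-hit splits -/

section Splits

/-- **The last move of the largest disc, read backwards.** On a walk of `H^{n+1}_{P_{1+3}}` that starts with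
the largest disc on peg `3` and ends with it elsewhere, the FIRST move of the largest disc goes `3 → 2`
while all smaller discs sit on the pegs `0, 1` (the print's «Before the last move of disk $n$ (to peg $h$),
a configuration $C'$, in which all $n-1$ disks … are distributed among pegs $1,\ldots,h-2$, is reached»).
[cite: BerendSapirSolomon2012, Lemma 4.1 (proof)] -/
private theorem bssh_exists_first_move_last {n : ℕ} {u v : Fin (n + 1) → Fin 4}
    (p : (stateGraph path4 (n + 1)).Walk u v) (hu : u (Fin.last n) = 3) (hv : v (Fin.last n) ≠ 3) :
    ∃ (x y : Fin (n + 1) → Fin 4) (p₁ : (stateGraph path4 (n + 1)).Walk u x)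
      (p₂ : (stateGraph path4 (n + 1)).Walk y v),
      p₁.length + 1 + p₂.length = p.length ∧ x (Fin.last n) = 3 ∧ y (Fin.last n) = 2 ∧
        Fin.init y = Fin.init x ∧ ∀ i : Fin n, (x (Fin.castSucc i)).val ≤ 1 := by
  revert hu hv
  induction p with
  | nil => exact fun hu hv => absurd hu hv
  | @cons a b c h p ih =>
    intro hu hv
    by_cases hb : b (Fin.last n) = 3
    · obtain ⟨x, y, p₁, p₂, hlen, hx, hy, hinit, hsmall⟩ := ih hb hv
      refine ⟨x, y, Walk.cons h p₁, p₂, ?_, hx, hy, hinit, hsmall⟩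
      rw [Walk.length_cons, Walk.length_cons]
      omega
    · obtain ⟨d, had, hoff, hsm⟩ := h
      have hd : d = Fin.last n := by
        by_contra hne
        exact hb ((hoff _ fun h => hne h.symm).trans hu)
      subst hd
      rw [hu] at had
      have hb2 : b (Fin.last n) = 2 := bssh_eq_two_of_adj_three had
      refine ⟨a, b, Walk.nil, p, ?_, hu, hb2, ?_, fun i => ?_⟩
      · rw [Walk.length_nil, Walk.length_cons]
        omega
      · funext i
        exact hoff (Fin.castSucc i) (Fin.castSucc_lt_last i).ne
      · obtain ⟨h1, h2⟩ := hsm (Fin.castSucc i) (Fin.castSucc_lt_last i)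
        rw [hu] at h1
        rw [hb2] at h2
        exact bssh_val_le_one h1 h2

/-- **«reaching peg $h-2$ for the first time».** On a walk of `H^{n+1}_{P_{1+3}}` that starts with the
largest disc on one of the pegs `0, 1` and ends with it on peg `2`, some state of the walk has the largest
disc on peg `1`. [cite: BerendSapirSolomon2012, Lemma 4.1 (proof)] -/
private theorem bssh_exists_first_arrival_one {n : ℕ} {u v : Fin (n + 1) → Fin 4}
    (p : (stateGraph path4 (n + 1)).Walk u v) (hu : (u (Fin.last n)).val ≤ 1)
    (hv : v (Fin.last n) = 2) :
    ∃ (w : Fin (n + 1) → Fin 4) (p₁ : (stateGraph path4 (n + 1)).Walk u w)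
      (p₂ : (stateGraph path4 (n + 1)).Walk w v), p₁.length + p₂.length = p.length ∧ w (Fin.last n) = 1 := by
  revert hu hv
  induction p with
  | nil =>
    intro hu hv
    rw [hv] at hu
    exact absurd hu (by decide)
  | @cons a b c h p ih =>
    intro hu hv
    by_cases ha : a (Fin.last n) = 1
    · exact ⟨a, Walk.nil, Walk.cons h p, by simp, ha⟩
    · have ha0 : a (Fin.last n) = 0 := bssh_eq_zero hu ha
      by_cases hb : (b (Fin.last n)).val ≤ 1
      · obtain ⟨w, p₁, p₂, hlen, hw⟩ := ih hb hv
        refine ⟨w, Walk.cons h p₁, p₂, ?_, hw⟩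
        rw [Walk.length_cons, Walk.length_cons]
        omega
      · exfalso
        obtain ⟨d, had, hoff, hsm⟩ := h
        have hd : d = Fin.last n := by
          by_contra hne
          apply hb
          rw [hoff _ fun h => hne h.symm]
          exact hu
        subst hd
        rw [ha0] at had
        have hb1 : b (Fin.last n) = 1 := bssh_eq_one_of_adj_zero had
        apply hb
        rw [hb1]
        decide

end Splits

/-! ## Lemma 4.1 of [50] for `h = 4` -/

section Lemma41

/-- **The inductive step of Lemma 4.1** with a WEAK hypothesis: if for every configuration `C'` of `n` discs
on the pegs `{0,1}` one has `d(C',1ⁿ) ≤ d(C',3ⁿ)` and `d(C',2ⁿ) ≤ d(C',3ⁿ)`, then for every configuration `C`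
of `n+1` discs on the pegs `{0,1}` both inequalities hold STRICTLY — the print's surgery «Concatenating
$M'_{h-2}$ with $M''_{h-2}$, we obtain a legal move-sequence, strictly shorter than $M$», the strictness
coming from the omitted last move of the largest disc. [cite: BerendSapirSolomon2012, Lemma 4.1 (proof)] -/
private theorem bssh_lemma41_step {n : ℕ}
    (ih : ∀ C' : Fin n → Fin 4, (∀ i, (C' i).val ≤ 1) →
      (stateGraph path4 n).dist C' (fun _ => 1) ≤ (stateGraph path4 n).dist C' (fun _ => 3) ∧
        (stateGraph path4 n).dist C' (fun _ => 2) ≤ (stateGraph path4 n).dist C' (fun _ => 3))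
    (C : Fin (n + 1) → Fin 4) (hC : ∀ i, (C i).val ≤ 1) :
    (stateGraph path4 (n + 1)).dist C (fun _ => 1) < (stateGraph path4 (n + 1)).dist C (fun _ => 3) ∧
      (stateGraph path4 (n + 1)).dist C (fun _ => 2) < (stateGraph path4 (n + 1)).dist C (fun _ => 3) := by
  have hconn : (stateGraph path4 (n + 1)).Connected := bssh_connected (n + 1)
  -- a geodesic `C → 3^{n+1}`, read backwards, split at the first move of the largest disc
  obtain ⟨W, hW⟩ := hconn.exists_walk_length_eq_dist C (fun _ => 3)
  have h3 : (fun _ : Fin (n + 1) => (3 : Fin 4)) (Fin.last n) = 3 := rfl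
  have hC3 : C (Fin.last n) ≠ 3 := by
    intro h
    have := hC (Fin.last n)
    rw [h] at this
    exact absurd this (by decide)
  obtain ⟨x, y, p₁, p₂, hlen, hx, hy, hinit, hsmall⟩ := bssh_exists_first_move_last W.reverse h3 hC3
  -- the print's `C'`: the smaller discs at that moment, all on the pegs `{0,1}`
  obtain ⟨ih1, ih2⟩ := ih (Fin.init x) hsmall
  have hxs : (Fin.snoc (Fin.init x) 3 : Fin (n + 1) → Fin 4) = x := by
    have := Fin.snoc_init_self x
    rwa [hx] at this
  have hys : (Fin.snoc (Fin.init x) 2 : Fin (n + 1) → Fin 4) = y := by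
    have := Fin.snoc_init_self y
    rwa [hy, hinit] at this
  -- `|M| = |M'| + 1 + |M''|` in distance form
  have hkey : (stateGraph path4 (n + 1)).dist C y + 1 + (stateGraph path4 (n + 1)).dist x (fun _ => 3) ≤
      (stateGraph path4 (n + 1)).dist C (fun _ => 3) := by
    have a1 : (stateGraph path4 (n + 1)).dist C y ≤ p₂.length := by
      rw [SimpleGraph.dist_comm]
      exact dist_le p₂
    have a2 : (stateGraph path4 (n + 1)).dist x (fun _ => 3) ≤ p₁.length := by
      rw [SimpleGraph.dist_comm]
      exact dist_le p₁
    have a3 : W.reverse.length = W.length := Walk.length_reverse W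
    omega
  -- `M''` projected to the smaller discs: `d_n(C', 3ⁿ) ≤ d(x, 3^{n+1})`
  have hproj : (stateGraph path4 n).dist (Fin.init x) (fun _ => 3) ≤
      (stateGraph path4 (n + 1)).dist x (fun _ => 3) := by
    have e : Fin.init (fun _ : Fin (n + 1) => (3 : Fin 4)) = fun _ => 3 := rfl
    have := bssh_dist_init_le x (fun _ => (3 : Fin 4))
    rwa [e] at this
  -- the second inequality: `C → y = C'2` (this is `M'`, disc `n+1` has just reached peg `2`), then `M''₃` lifted
  have hB : (stateGraph path4 (n + 1)).dist C (fun _ => 2) < (stateGraph path4 (n + 1)).dist C (fun _ => 3) := by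
    have t1 : (stateGraph path4 (n + 1)).dist C (fun _ => 2) ≤
        (stateGraph path4 (n + 1)).dist C y + (stateGraph path4 (n + 1)).dist y (fun _ => 2) :=
      hconn.dist_triangle
    have t2 : (stateGraph path4 (n + 1)).dist y (fun _ => 2) ≤ (stateGraph path4 n).dist (Fin.init x) (fun _ => 2) := by
      have := bssh_dist_snoc_le (Fin.init x) (fun _ => (2 : Fin 4)) 2
      rwa [hys, bssh_snoc_const] at this
    omega
  -- the first inequality: one more split of `M'` at the first arrival of disc `n+1` on peg `1`
  have hA : (stateGraph path4 (n + 1)).dist C (fun _ => 1) < (stateGraph path4 (n + 1)).dist C (fun _ => 3) := by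
    obtain ⟨q, hq⟩ := hconn.exists_walk_length_eq_dist C y
    obtain ⟨w, q₁, q₂, hqlen, hw⟩ := bssh_exists_first_arrival_one q (hC (Fin.last n)) hy
    have hws : (Fin.snoc (Fin.init w) 1 : Fin (n + 1) → Fin 4) = w := by
      have := Fin.snoc_init_self w
      rwa [hw] at this
    -- `d(C, w) + d(w, y) ≤ d(C, y)`
    have s1 : (stateGraph path4 (n + 1)).dist C w + (stateGraph path4 (n + 1)).dist w y ≤
        (stateGraph path4 (n + 1)).dist C y := by
      have a1 : (stateGraph path4 (n + 1)).dist C w ≤ q₁.length := dist_le q₁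
      have a2 : (stateGraph path4 (n + 1)).dist w y ≤ q₂.length := dist_le q₂
      omega
    -- «omitting all moves disk n makes after reaching peg h−2»: `d(w, C'1) ≤ d(w, y)` by projection and lift
    have s2 : (stateGraph path4 (n + 1)).dist w (Fin.snoc (Fin.init x) 1) ≤ (stateGraph path4 (n + 1)).dist w y := by
      have b1 := bssh_dist_snoc_le (Fin.init w) (Fin.init y) 1
      rw [hws] at b1
      rw [← hinit]
      exact b1.trans (bssh_dist_init_le w y)
    have s3 : (stateGraph path4 (n + 1)).dist C (Fin.snoc (Fin.init x) 1) ≤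
        (stateGraph path4 (n + 1)).dist C w + (stateGraph path4 (n + 1)).dist w (Fin.snoc (Fin.init x) 1) :=
      hconn.dist_triangle
    -- `M''₁` lifted under the idle disc on peg `1`
    have s4 : (stateGraph path4 (n + 1)).dist (Fin.snoc (Fin.init x) 1) (fun _ => 1) ≤
        (stateGraph path4 n).dist (Fin.init x) (fun _ => 1) := by
      have := bssh_dist_snoc_le (Fin.init x) (fun _ => (1 : Fin 4)) 1
      rwa [bssh_snoc_const] at this
    have s5 : (stateGraph path4 (n + 1)).dist C (fun _ => 1) ≤
        (stateGraph path4 (n + 1)).dist C (Fin.snoc (Fin.init x) 1) +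
          (stateGraph path4 (n + 1)).dist (Fin.snoc (Fin.init x) 1) (fun _ => 1) :=
      hconn.dist_triangle
    omega
  exact ⟨hA, hB⟩

/-- **Lemma 4.1 in the weak form, all `n`** (the induction of the print, started at the empty configuration).
[cite: BerendSapirSolomon2012, Lemma 4.1] -/
private theorem bssh_lemma41_weak : ∀ (n : ℕ) (C : Fin n → Fin 4), (∀ i, (C i).val ≤ 1) →
    (stateGraph path4 n).dist C (fun _ => 1) ≤ (stateGraph path4 n).dist C (fun _ => 3) ∧
      (stateGraph path4 n).dist C (fun _ => 2) ≤ (stateGraph path4 n).dist C (fun _ => 3)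
  | 0, C, _ => by
    have h : ∀ s : Fin 0 → Fin 4, s = C := fun s => funext fun i => i.elim0
    rw [h (fun _ => 1), h (fun _ => 2), h (fun _ => 3)]
    exact ⟨le_rfl, le_rfl⟩
  | n + 1, C, hC => by
    obtain ⟨h1, h2⟩ := bssh_lemma41_step (bssh_lemma41_weak n) C hC
    exact ⟨h1.le, h2.le⟩

/-- **[50, Lemma 4.1] for `h = 4`**, on the tree's labels (`path4 = 0 – 1 – 2 – 3` = the source's pegs `1, 2,
3, 4`): «Let $C$ be a configuration with $n \ge 1$ disks, arranged arbitrarily on pegs $1,\ldots,h-2$, with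
pegs $h-1$ and $h$ empty. Then: $|C \rightarrow R_{h,h-2,n}| < |C \rightarrow R_{h,h,n}|$, $\quad |C
\rightarrow R_{h,h-1,n}| < |C \rightarrow R_{h,h,n}|$.» — for every state `C` of `n+1` discs all on the
pegs `0, 1`: `d(C, 1^{n+1}) < d(C, 3^{n+1})` and `d(C, 2^{n+1}) < d(C, 3^{n+1})` in `H^{n+1}_{P_{1+3}}`.
[cite: BerendSapirSolomon2012, Lemma 4.1] -/
theorem bss_lemma41 (n : ℕ) (C : Fin (n + 1) → Fin 4) (hC : ∀ i, (C i).val ≤ 1) :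
    (stateGraph path4 (n + 1)).dist C (fun _ => 1) < (stateGraph path4 (n + 1)).dist C (fun _ => 3) ∧
      (stateGraph path4 (n + 1)).dist C (fun _ => 2) < (stateGraph path4 (n + 1)).dist C (fun _ => 3) :=
  bssh_lemma41_step (bssh_lemma41_weak n) C hC

end Lemma41

/-! ## «Due to symmetries»: the reflection of the path, and Theorem 3.2 (a) -/

section Theorem32a

/-- The reflection `i ↦ 3 − i` of `P_{1+3}`, applied to every disc, does not increase distances in
`H^n_{P_{1+3}}` (a graph homomorphism, the tree's `pegMapHom`). [folklore] -/
private theorem bssh_dist_rev_le {n : ℕ} (s t : Fin n → Fin 4) :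
    (stateGraph path4 n).dist (Fin.rev ∘ s) (Fin.rev ∘ t) ≤ (stateGraph path4 n).dist s t := by
  have h := bssh_dist_map_le (pegMapHom path4 path4 n Fin.rev Fin.rev_injective fun _ _ h => bssh_adj_rev h)
    ((bssh_connected n).preconnected s t)
  rwa [pegMapHom_apply, pegMapHom_apply] at h

/-- «Due to symmetries»: the reflection `i ↦ 3 − i` of the path preserves distances in `H^n_{P_{1+3}}`.
[cite: BerendSapirSolomon2012, §4.1 (proof of Theorem 3.2 (a))] -/
private theorem bssh_dist_rev {n : ℕ} (s t : Fin n → Fin 4) :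
    (stateGraph path4 n).dist (Fin.rev ∘ s) (Fin.rev ∘ t) = (stateGraph path4 n).dist s t := by
  refine le_antisymm (bssh_dist_rev_le s t) ?_
  have h := bssh_dist_rev_le (Fin.rev ∘ s) (Fin.rev ∘ t)
  have e : ∀ r : Fin n → Fin 4, Fin.rev ∘ (Fin.rev ∘ r) = r := fun r => funext fun i => Fin.rev_rev (r i)
  rwa [e, e] at h

/-- The pairs `i < j`, `(i, j) ≠ (0, 3)` of pegs. [folklore] -/
private theorem bssh_pairs_cases (i j : Fin 4) (hij : i < j) (hne : (i, j) ≠ ((0 : Fin 4), (3 : Fin 4))) :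
    (i = 0 ∧ j = 1) ∨ (i = 0 ∧ j = 2) ∨ (i = 1 ∧ j = 2) ∨ (i = 1 ∧ j = 3) ∨ (i = 2 ∧ j = 3) := by
  revert i j hij hne
  decide

/-- **Berend–Sapir–Solomon's hardest task, PROVED** — the named fact `BerendSapirSolomonHardest` holds: for `n
≥ 1` and pegs `i < j`, `(i, j) ≠ (0, 3)` of `P_{1+3} = 0 – 1 – 2 – 3`, the perfect task `iⁿ → jⁿ` is
strictly shorter than the end-to-end task `0ⁿ → 3ⁿ` ([50, Theorem 3.2 (a)]: «$|R_{4,i,n} \rightarrow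
R_{4,j,n}| < |R_{4,1,n} \rightarrow R_{4,4,n}|$ for $1 \le i < j \le 4$, $(i,j) \neq (1,4)$. In
particular, Path($4,n$) = $|R_{4,1,n} \rightarrow R_{4,4,n}|$.»), by Lemma 4.1 at the perfect configurations
`0ⁿ`, `1ⁿ` and the reflection of the path, exactly as printed: `d(0,1) < d(0,3)`; `d(1,2) < d(1,3) = d(0,2)
< d(0,3)`; `d(2,3) = d(0,1)`.
[cite: HinzKlavzarPetr2018, Ch. 8 §8.3.5, p. 349 (ref. 50 = Berend, D., Sapir, A., Solomon, S., The Tower of Hanoi problem on Path_h graphs, Discrete Appl. Math. 160 (2012) 1465–1483, Theorem 3.2 (a))] -/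
theorem BerendSapirSolomonHardest_holds : BerendSapirSolomonHardest := by
  intro n hn i j hij hne
  obtain ⟨m, rfl⟩ : ∃ m, n = m + 1 := ⟨n - 1, by omega⟩
  have h0 := bss_lemma41 m (fun _ => (0 : Fin 4)) (fun _ => by decide)
  have h1 := bss_lemma41 m (fun _ => (1 : Fin 4)) (fun _ => by decide)
  have e1 : (Fin.rev ∘ fun _ : Fin (m + 1) => (1 : Fin 4)) = fun _ => 2 :=
    funext fun _ => (show Fin.rev (1 : Fin 4) = 2 by decide)
  have e2 : (Fin.rev ∘ fun _ : Fin (m + 1) => (2 : Fin 4)) = fun _ => 1 :=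
    funext fun _ => (show Fin.rev (2 : Fin 4) = 1 by decide)
  have e3 : (Fin.rev ∘ fun _ : Fin (m + 1) => (3 : Fin 4)) = fun _ => 0 :=
    funext fun _ => (show Fin.rev (3 : Fin 4) = 0 by decide)
  have r13 : (stateGraph path4 (m + 1)).dist (fun _ => 1) (fun _ => 3) =
      (stateGraph path4 (m + 1)).dist (fun _ => 0) (fun _ => 2) := by
    rw [← bssh_dist_rev (fun _ => (1 : Fin 4)) (fun _ => 3), e1, e3, SimpleGraph.dist_comm]
  have r23 : (stateGraph path4 (m + 1)).dist (fun _ => 2) (fun _ => 3) =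
      (stateGraph path4 (m + 1)).dist (fun _ => 0) (fun _ => 1) := by
    rw [← bssh_dist_rev (fun _ => (2 : Fin 4)) (fun _ => 3), e2, e3, SimpleGraph.dist_comm]
  rcases bssh_pairs_cases i j hij hne with ⟨rfl, rfl⟩ | ⟨rfl, rfl⟩ | ⟨rfl, rfl⟩ | ⟨rfl, rfl⟩ | ⟨rfl, rfl⟩
  · exact h0.1
  · exact h0.2
  · calc (stateGraph path4 (m + 1)).dist (fun _ => 1) (fun _ => 2)
        < (stateGraph path4 (m + 1)).dist (fun _ => 1) (fun _ => 3) := h1.2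
      _ = (stateGraph path4 (m + 1)).dist (fun _ => 0) (fun _ => 2) := r13
      _ < (stateGraph path4 (m + 1)).dist (fun _ => 0) (fun _ => 3) := h0.2
  · rw [r13]
    exact h0.2
  · rw [r23]
    exact h0.1

end Theorem32a

end Literature.Combinatorics.Hinz2018.MoveGraph
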